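import Summits.QuantumFields.YangMills.Theorems.UnitScaleTiltProp7CombTrueStepSplit
import Literature.MathematicalPhysics.QuantumFieldTheory.Balaban1983to89.B7Prop1Local
import HarnessLib

/-!
# Route `UnitScaleTilt`, crux K1 «MinimiserStabilityRegPr» (stmt-QuantumFields-19200), route-R E′ (A′)-on-Σ, P-A2 (β), row «(n3)-comb» —
# (O2) GROUNDWORK, file F-5b: LOCALITY OF THE COVARIANT WALK SUMS OF (42) AND THE ONE-STEP DEFECT IN TWO-BLOCK `ℓ²` CURRENCY:
# `‖DEF_{V₀}(c)‖ ≤ 210·(2d+2)L·α·√(Σ_{b ⊂ B(c₋) ∪ B(c₊)} ‖X_b‖²)`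

«(O2) groundwork — not consumed by any displayed row before the freeze lifts» (★★OWNER `ym3-torus-plan` g29 RULINGS №20 (2), №22; «(II) GO» 06:26∕06:31Z).
Cell `ym3-torus`, D-0154 (3c) R3 twin-width seat `ym-routeR-w1` (gen 9); DESIGN memo `DESIGN-N3COMB-LINEAR-CORE-routeRw1g9.md` §1 rows 1∕4, file list §5 F-5.
THEOREMS ONLY (0 `def`, 0 `sorry`); `--supports stmt-QuantumFields-19200 --as helper`, count-neutral.  YM₃ on T³ is a ladder rung (R3), not the Clay problem; nothing here claims
`hMcomb`, `hMcomb₂`, (β), `hPA2`, `hcoS`, the stub, the crux, d = 4 or the mass gap.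

THE POINT.  ✓`Prop7CombTrueStepSplit.norm_trueStep_sub_split_le` (F-5a) bounds the one-step defect of print's single bar by `210·α·m`, `m` a bound of the NORMS of the
covariant walk sums of `X` along the block loops `Γ_{c,x} ∪ (−c)`, the segment `[c₋, c₊]` and the trees at `c₊`.  For the `ℓ²` recursion of the design (pattern of the sym
✓`Prop7TrueLinDefectBound`: «every walk at `c` lives on the two blocks of `c`») these norms are bounded by `|walk| · √(two-block ℓ² mass of X)`: (i) LOCALITY — the covariant
walk sum `(R_{0,p}X)(Γ)` along a word inside the box `B(c₋) ∪ B(c₊) = [q, bondHi L q κ]` (lit `B7Prop1Local.bondHi`) depends only on `X` on the bonds of that box (the `X`-twin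
of lit ✓`B7Prop1Local.hol_treeWord_congr` ∕ `Wcx_congr`, same `InBox` bookkeeping); (ii) so it equals the walk sum of the RESTRICTED field (zero outside), whose sup norm is at
most `√(Σ_{two blocks}‖X‖²)` (a single term is at most the `ℓ²` norm); (iii) lit ✓`norm_tsum_le` (`‖(R_{0,p}X)(Γ)‖ ≤ |Γ|·sup‖X‖`) and the lengths `|Γ_{c,x} ∪ (−c)| ≤ (2d+2)L`.

WHAT IS PROVED (ns `…Theorems.Prop7CombTrueStepDefectTwoBlock`; `𝔸` as in F-5a (C⋆-algebra) for §3, any normed ring for §1–§2; every `d`, `L ≥ 1`).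
* §1 `tsum_seg_congr`, `tsum_seg_neg_congr`, `tsum_flatMap_seg_congr`, `tsum_treeWord_congr`, `tsum_append_congr`, `tsum_loop_congr` — locality of `(R_{0,p}X)(Γ)` in `X` for the words of (42).
* §2 `inBox_two_blocks` (a point of `[q, bondHi]` is `q + r` or `q + Le_κ + r`, `r ∈ [0,L)ᵈ`), `norm_restrict_le_sqrt_twoBlock`, ★ `norm_tsum_le_length_mul_sqrt_twoBlock`.
* §3 ★★ `norm_trueStep_defect_le_twoBlock` — the title (F-5a with `m := (2d+2)L·√(two-block mass)`).
HONEST SCOPE.  One coarse bond; the sum over a period cell (multiplicity `2d` of the blocks) is F-5c.  Nothing of Bałaban's is asserted beyond the cited tree∕lit theorems.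

References: T. Bałaban, CMP **98** (1985) 17–51 [Balaban1985Averaging] ((42) p.23, p.24 (locality sentence after (43)), (46) p.25, (58) p.27, (124) p.36); CMP **109** (1987) 249–301
[Balaban1987RG1] ((0.4) p.253).
-/

noncomputable section

open scoped BigOperators

namespace Summit.QuantumFields.YangMills.Theorems.Prop7CombTrueStepDefectTwoBlock

open NormedSpace
open Literature.MathematicalPhysics.QuantumFieldTheory.Balaban1983to89
open ExpMeanLog (eml)
open B7Prop1Explicit (Site Letter e hol stepHol seg treeWord boxVec gammaWord Wcx Xavg bavg expUnit U1 disp revWord hol_cons)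
open B7Prop1Local (InBox AgreeOn bondHi inBox_add_e inBox_of_between add_zsmul_e_apply add_e_apply)
open B7Prop2Explicit (avgIter unitaryUnits unitaryUnits_le_U1)
open B7Eq78Linearization (conjR conjR_apply)
open B7Prop3GeneralRotated (tsum tstep tsum_cons tsum_append norm_tsum_le)
open B7Prop3GeneralLinear (FhatCov Q0cov)
open B7Prop3GeneralLinearSplit (tsum_revWord)
open Summit.QuantumFields.YangMills.Theorems.Prop7CombTrueStepSplit (norm_trueStep_sub_split_le)

section Locality

variable {d : ℕ} {𝔸 : Type*} [NormedRing 𝔸] {lo hi : Site d} (V : Site d → Fin d → 𝔸ˣ) {X X' : Site d → Fin d → 𝔸}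

/-! ## §1 Locality of the covariant walk sums in the field -/

/-- Locality along a forward straight segment `[p, p + n e_κ]` inside the box. [cite: Balaban1985Averaging, p.24] -/
theorem tsum_seg_congr (h : AgreeOn lo hi X X') (κ : Fin d) :
    ∀ (n : ℕ) (p : Site d), InBox lo hi p → InBox lo hi (p + (n : ℤ) • e κ) →
      tsum V X p (seg κ n) = tsum V X' p (seg κ n)
  | 0, p, _, _ => by simp
  | n + 1, p, hp, hpn => by
    have hpe : InBox lo hi (p + e κ) := inBox_add_e hp hpn
    have hpn' : InBox lo hi (p + e κ + (n : ℤ) • e κ) := by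
      have he : p + e κ + (n : ℤ) • e κ = p + ((n + 1 : ℕ) : ℤ) • e κ := by
        push_cast; rw [add_smul, one_smul]; abel
      rw [he]; exact hpn
    rw [B7Prop1Explicit.seg_natCast, List.replicate_succ, tsum_cons, tsum_cons, B7Prop1Explicit.Letter.vec_true,
      ← B7Prop1Explicit.seg_natCast, tsum_seg_congr h κ n (p + e κ) hpe hpn']
    unfold tstep
    simp only [↓reduceIte]
    rw [h p κ hp hpe]

/-- Locality along a backward straight segment `seg κ (−n)` from `p + n e_κ` (reduced to the forward one by lit ✓`tsum_revWord`). [cite: Balaban1985Averaging, p.24] -/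
theorem tsum_seg_neg_congr (h : AgreeOn lo hi X X') (κ : Fin d) (n : ℕ) (p : Site d) (hp : InBox lo hi p)
    (hpn : InBox lo hi (p + (n : ℤ) • e κ)) :
    tsum V X (p + (n : ℤ) • e κ) (seg κ (-(n : ℤ))) = tsum V X' (p + (n : ℤ) • e κ) (seg κ (-(n : ℤ))) := by
  have hx : p + (n : ℤ) • e κ = p + disp (seg κ (n : ℤ)) := by rw [B7Prop1Explicit.disp_seg]
  rw [← B7Prop1Explicit.revWord_seg, hx, tsum_revWord, tsum_revWord, tsum_seg_congr V h κ n p hp hpn]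

/-- Locality along a broken line changing the coordinates listed in `s` one at a time (nonnegative increments). [cite: Balaban1985Averaging, p.24] -/
theorem tsum_flatMap_seg_congr (h : AgreeOn lo hi X X') (v : Site d) (hv0 : ∀ κ, 0 ≤ v κ) :
    ∀ (s : List (Fin d)), s.Nodup → ∀ p : Site d, InBox lo hi p →
      (∀ κ ∈ s, lo κ ≤ p κ + v κ ∧ p κ + v κ ≤ hi κ) →
      tsum V X p (s.flatMap fun κ => seg κ (v κ)) = tsum V X' p (s.flatMap fun κ => seg κ (v κ))
  | [], _, p, _, _ => by simp
  | κ :: s, hnd, p, hp, hv => by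
    obtain ⟨hκs, hs⟩ := List.nodup_cons.mp hnd
    rw [List.flatMap_cons, tsum_append, tsum_append, B7Prop1Explicit.disp_seg]
    have hκ := hv κ (by simp)
    have hpκ : InBox lo hi (p + v κ • e κ) := fun i => by
      rw [add_zsmul_e_apply]
      by_cases hi : i = κ
      · subst hi; simpa using hκ
      · simpa [hi] using hp i
    obtain ⟨n, hn⟩ := Int.eq_ofNat_of_zero_le (hv0 κ)
    have hseg : tsum V X p (seg κ (v κ)) = tsum V X' p (seg κ (v κ)) := by
      rw [hn]; exact tsum_seg_congr V h κ n p hp (by rw [← hn]; exact hpκ)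
    rw [hseg, tsum_flatMap_seg_congr h v hv0 s hs (p + v κ • e κ) hpκ ?_]
    intro κ' hκ'
    have hne : κ' ≠ κ := fun h' => hκs (h' ▸ hκ')
    rw [add_zsmul_e_apply, if_neg hne, add_zero]
    exact hv κ' (by simp [hκ'])

/-- LOCALITY ALONG THE TREE CONTOUR `Γ_{p, p+v}` (`v ≥ 0`) inside a box containing `p` and `p + v`. [cite: Balaban1985Averaging, p.24] -/
theorem tsum_treeWord_congr (h : AgreeOn lo hi X X') (p v : Site d) (hv0 : ∀ κ, 0 ≤ v κ) (hp : InBox lo hi p)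
    (hpv : InBox lo hi (p + v)) : tsum V X p (treeWord v) = tsum V X' p (treeWord v) :=
  tsum_flatMap_seg_congr V h v hv0 _ (List.nodup_reverse.mpr (List.nodup_finRange d)) p hp fun κ _ => by simpa using hpv κ

/-- Locality is stable under concatenation (lit ✓`tsum_append`; the transport `V(Γ₁)` is common to both fields). [folklore] -/
theorem tsum_append_congr (p : Site d) (a b : List (Letter d)) (ha : tsum V X p a = tsum V X' p a)
    (hb : tsum V X (p + disp a) b = tsum V X' (p + disp a) b) : tsum V X p (a ++ b) = tsum V X' p (a ++ b) := by
  rw [tsum_append, tsum_append, ha, hb]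

/-- LOCALITY ALONG THE BLOCK LOOP `Γ_{c,x} ∪ (−c)` of (42): it is determined by `X` on the bonds of any box containing `c₋ = q`, `x = q + r`, `x + Le_κ`, `c₊ = q + Le_κ`
(`r ≥ 0`). [cite: Balaban1985Averaging, (42) p.23, p.24] -/
theorem tsum_loop_congr (L : ℕ) (h : AgreeOn lo hi X X') (q : Site d) (κ : Fin d) (r : Site d) (hr0 : ∀ i, 0 ≤ r i)
    (hq : InBox lo hi q) (hqr : InBox lo hi (q + r)) (hqrL : InBox lo hi (q + r + (L : ℤ) • e κ)) (hqL : InBox lo hi (q + (L : ℤ) • e κ)) :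
    tsum V X q (gammaWord L κ r ++ seg κ (-(L : ℤ))) = tsum V X' q (gammaWord L κ r ++ seg κ (-(L : ℤ))) := by
  have hqLr : InBox lo hi (q + (L : ℤ) • e κ + r) := by convert hqrL using 1; abel
  -- the reversed tree from `x + Le_κ` back to `c₊`
  have hrev : tsum V X (q + disp (treeWord r ++ seg κ (L : ℤ))) (revWord (treeWord r))
      = tsum V X' (q + disp (treeWord r ++ seg κ (L : ℤ))) (revWord (treeWord r)) := by
    have hx : q + disp (treeWord r ++ seg κ (L : ℤ)) = q + (L : ℤ) • e κ + disp (treeWord r) := by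
      rw [B7Prop1Explicit.disp_append, B7Prop1Explicit.disp_treeWord, B7Prop1Explicit.disp_seg]; abel
    rw [hx, tsum_revWord, tsum_revWord, tsum_treeWord_congr V h _ r hr0 hqL hqLr]
  -- the returning segment `−c` from `c₊`
  have hback : tsum V X (q + disp (gammaWord L κ r)) (seg κ (-(L : ℤ))) = tsum V X' (q + disp (gammaWord L κ r)) (seg κ (-(L : ℤ))) := by
    rw [B7Prop1Explicit.disp_gammaWord]
    exact tsum_seg_neg_congr V h κ L q hq hqL
  refine tsum_append_congr V q _ _ ?_ hback
  unfold gammaWord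
  refine tsum_append_congr V q _ _ (tsum_append_congr V q _ _ (tsum_treeWord_congr V h q r hr0 hq hqr) ?_) hrev
  rw [B7Prop1Explicit.disp_treeWord]
  exact tsum_seg_congr V h κ L (q + r) hqr hqrL

end Locality

section TwoBlock

variable {d : ℕ} {𝔸 : Type*} [NormedRing 𝔸] [NormOneClass 𝔸]

/-! ## §2 The two blocks of an `L`-bond and the restricted field -/

/-- A point of the box `[q, bondHi L q κ] = B(c₋) ∪ B(c₊)` is `q + r` or `q + Le_κ + r` with `r ∈ [0,L)ᵈ`. [cite: Balaban1985Averaging, p.24] -/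
theorem inBox_two_blocks (L : ℕ) (hL : 1 ≤ L) (q : Site d) (κ : Fin d) (y : Site d) (hy : InBox q (bondHi L q κ) y) :
    (∃ r : Fin d → Fin L, y = q + boxVec L r) ∨ (∃ r : Fin d → Fin L, y = q + (L : ℤ) • e κ + boxVec L r) := by
  have hy' : ∀ i, q i ≤ y i ∧ y i ≤ q i + ((L : ℤ) - 1) + if i = κ then (L : ℤ) else 0 := fun i => hy i
  by_cases hκ : y κ < q κ + L
  · left
    have hlt : ∀ i, y i < q i + L := fun i => by
      by_cases hi : i = κ
      · rw [hi]; exact hκ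
      · have h2 := (hy' i).2; rw [if_neg hi] at h2; omega
    refine ⟨fun i => ⟨(y i - q i).toNat, by have := hlt i; have := (hy' i).1; omega⟩, ?_⟩
    funext i
    have h1 := (hy' i).1
    simp only [Pi.add_apply, boxVec, Int.toNat_of_nonneg (sub_nonneg.2 h1)]
    ring
  · right
    rw [not_lt] at hκ
    refine ⟨fun i => ⟨(y i - q i - if i = κ then (L : ℤ) else 0).toNat, ?_⟩, ?_⟩
    · have h1 := (hy' i).1; have h2 := (hy' i).2
      by_cases hi : i = κ
      · subst hi; rw [if_pos rfl] at h2 ⊢; omega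
      · rw [if_neg hi] at h2 ⊢; omega
    · funext i
      have h1 := (hy' i).1; have h2 := (hy' i).2
      have hnn : 0 ≤ y i - q i - (if i = κ then (L : ℤ) else 0) := by
        by_cases hi : i = κ
        · subst hi; rw [if_pos rfl]; omega
        · rw [if_neg hi]; omega
      simp only [Pi.add_apply, boxVec, Pi.smul_apply, B7Prop1Explicit.e_apply, smul_eq_mul, mul_ite, mul_one, mul_zero,
        Int.toNat_of_nonneg hnn]
      ring

omit [NormOneClass 𝔸] in
/-- A single bond of the two blocks is at most the two-block `ℓ²` mass: `‖X(q + r, μ)‖, ‖X(q + Le_κ + r, μ)‖ ≤ √(Σ_{s,ν}(‖X(q+s,ν)‖² + ‖X(q+Le_κ+s,ν)‖²))`. [folklore] -/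
theorem norm_le_sqrt_twoBlock (L : ℕ) (X : Site d → Fin d → 𝔸) (q : Site d) (κ : Fin d) (r : Fin d → Fin L) (μ : Fin d) :
    ‖X (q + boxVec L r) μ‖ ≤ Real.sqrt (∑ s : Fin d → Fin L, ∑ ν : Fin d, (‖X (q + boxVec L s) ν‖ ^ 2 + ‖X (q + (L : ℤ) • e κ + boxVec L s) ν‖ ^ 2)) ∧
    ‖X (q + (L : ℤ) • e κ + boxVec L r) μ‖ ≤ Real.sqrt (∑ s : Fin d → Fin L, ∑ ν : Fin d, (‖X (q + boxVec L s) ν‖ ^ 2 + ‖X (q + (L : ℤ) • e κ + boxVec L s) ν‖ ^ 2)) := by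
  have hle : ‖X (q + boxVec L r) μ‖ ^ 2 + ‖X (q + (L : ℤ) • e κ + boxVec L r) μ‖ ^ 2
      ≤ ∑ s : Fin d → Fin L, ∑ ν : Fin d, (‖X (q + boxVec L s) ν‖ ^ 2 + ‖X (q + (L : ℤ) • e κ + boxVec L s) ν‖ ^ 2) := by
    have h1 : ‖X (q + boxVec L r) μ‖ ^ 2 + ‖X (q + (L : ℤ) • e κ + boxVec L r) μ‖ ^ 2
        ≤ ∑ ν : Fin d, (‖X (q + boxVec L r) ν‖ ^ 2 + ‖X (q + (L : ℤ) • e κ + boxVec L r) ν‖ ^ 2) :=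
      Finset.single_le_sum (f := fun ν => ‖X (q + boxVec L r) ν‖ ^ 2 + ‖X (q + (L : ℤ) • e κ + boxVec L r) ν‖ ^ 2)
        (fun _ _ => by positivity) (Finset.mem_univ μ)
    exact h1.trans (Finset.single_le_sum (f := fun s => ∑ ν : Fin d, (‖X (q + boxVec L s) ν‖ ^ 2 + ‖X (q + (L : ℤ) • e κ + boxVec L s) ν‖ ^ 2))
      (fun _ _ => by positivity) (Finset.mem_univ r))
  constructor
  · refine Real.le_sqrt_of_sq_le (le_trans ?_ hle); nlinarith [sq_nonneg ‖X (q + (L : ℤ) • e κ + boxVec L r) μ‖]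
  · refine Real.le_sqrt_of_sq_le (le_trans ?_ hle); nlinarith [sq_nonneg ‖X (q + boxVec L r) μ‖]

open Classical in
/-- ★ **WALK NORM ≤ LENGTH × TWO-BLOCK `ℓ²` MASS**: for a `U1` background and a word `Γ` from `p` along which `(R_{0,p}X)(Γ)` is local in the box `[q, bondHi L q κ]`
(i.e. equal for any two fields agreeing on its bonds), `‖(R_{0,p}X)(Γ)‖ ≤ |Γ| · √(two-block mass of X at c)` — locality + restriction + lit ✓`norm_tsum_le`.
[cite: Balaban1985Averaging, p.24, (125)-(126) p.36] -/
theorem norm_tsum_le_length_mul_sqrt_twoBlock (L : ℕ) (hL : 1 ≤ L) {V : Site d → Fin d → 𝔸ˣ} (hV : ∀ x μ, V x μ ∈ U1 𝔸) (X : Site d → Fin d → 𝔸)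
    (q : Site d) (κ : Fin d) (p : Site d) (w : List (Letter d))
    (hloc : ∀ X' : Site d → Fin d → 𝔸, AgreeOn q (bondHi L q κ) X X' → tsum V X p w = tsum V X' p w) :
    ‖tsum V X p w‖ ≤ w.length * Real.sqrt (∑ s : Fin d → Fin L, ∑ ν : Fin d, (‖X (q + boxVec L s) ν‖ ^ 2 + ‖X (q + (L : ℤ) • e κ + boxVec L s) ν‖ ^ 2)) := by
  set M : ℝ := Real.sqrt (∑ s : Fin d → Fin L, ∑ ν : Fin d, (‖X (q + boxVec L s) ν‖ ^ 2 + ‖X (q + (L : ℤ) • e κ + boxVec L s) ν‖ ^ 2)) with hM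
  set X' : Site d → Fin d → 𝔸 := fun y μ => if InBox q (bondHi L q κ) y ∧ InBox q (bondHi L q κ) (y + e μ) then X y μ else 0 with hX'
  have hagree : AgreeOn q (bondHi L q κ) X X' := fun y μ hy hyμ => by rw [hX']; simp only [hy, hyμ, and_self, ↓reduceIte]
  have hsup : ∀ y μ, ‖X' y μ‖ ≤ M := by
    intro y μ
    by_cases hy : InBox q (bondHi L q κ) y ∧ InBox q (bondHi L q κ) (y + e μ)
    · have e1 : X' y μ = X y μ := by rw [hX']; simp only [hy, and_self, ↓reduceIte]
      rw [e1]
      rcases inBox_two_blocks L hL q κ y hy.1 with ⟨r, rfl⟩ | ⟨r, rfl⟩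
      · exact (norm_le_sqrt_twoBlock L X q κ r μ).1
      · exact (norm_le_sqrt_twoBlock L X q κ r μ).2
    · have e0 : X' y μ = 0 := by rw [hX']; simp only [hy, ↓reduceIte]
      rw [e0, norm_zero]; exact Real.sqrt_nonneg _
  rw [hloc X' hagree]
  exact norm_tsum_le hV hsup p w

end TwoBlock

section Defect

variable {d : ℕ} {𝔸 : Type*} [CStarAlgebra 𝔸] [Nontrivial 𝔸]

/-! ## §3 ★★ The one-step defect in two-block `ℓ²` currency -/

/-- `InBox` facts for the block loops of the `L`-bond `(q, κ)`: the corner, `q + r`, `q + r + Le_κ`, `q + Le_κ` (`r ∈ [0,L)ᵈ`) lie in `[q, bondHi L q κ]`, and `r ≥ 0`. [folklore] -/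
theorem inBox_loop_points (L : ℕ) (hL : 1 ≤ L) (q : Site d) (κ : Fin d) (r : Fin d → Fin L) :
    InBox q (bondHi L q κ) q ∧ InBox q (bondHi L q κ) (q + boxVec L r) ∧ InBox q (bondHi L q κ) (q + boxVec L r + (L : ℤ) • e κ) ∧
      InBox q (bondHi L q κ) (q + (L : ℤ) • e κ) ∧ (∀ i, 0 ≤ boxVec L r i) := by
  have hr : ∀ i, (0 : ℤ) ≤ ((r i : ℕ) : ℤ) ∧ ((r i : ℕ) : ℤ) + 1 ≤ L := fun i => ⟨by positivity, by have := (r i).isLt; omega⟩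
  refine ⟨fun i => ?_, fun i => ?_, fun i => ?_, fun i => ?_, fun i => by simp [boxVec]⟩
  · show q i ≤ q i ∧ q i ≤ q i + ((L : ℤ) - 1) + if i = κ then (L : ℤ) else 0
    split_ifs <;> constructor <;> omega
  · show q i ≤ (q + boxVec L r) i ∧ (q + boxVec L r) i ≤ q i + ((L : ℤ) - 1) + if i = κ then (L : ℤ) else 0
    have := hr i
    simp only [Pi.add_apply, boxVec]
    split_ifs <;> constructor <;> omega
  · show q i ≤ (q + boxVec L r + (L : ℤ) • e κ) i ∧ (q + boxVec L r + (L : ℤ) • e κ) i ≤ q i + ((L : ℤ) - 1) + if i = κ then (L : ℤ) else 0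
    have := hr i
    simp only [Pi.add_apply, boxVec, Pi.smul_apply, B7Prop1Explicit.e_apply, smul_eq_mul, mul_ite, mul_one, mul_zero]
    split_ifs <;> constructor <;> omega
  · show q i ≤ (q + (L : ℤ) • e κ) i ∧ (q + (L : ℤ) • e κ) i ≤ q i + ((L : ℤ) - 1) + if i = κ then (L : ℤ) else 0
    simp only [Pi.add_apply, Pi.smul_apply, B7Prop1Explicit.e_apply, smul_eq_mul, mul_ite, mul_one, mul_zero]
    split_ifs <;> constructor <;> omega

/-- ★★ **THE ONE-STEP DEFECT OF PRINT's SINGLE BAR IN TWO-BLOCK `ℓ²` CURRENCY**: under the hypotheses of ✓`norm_trueStep_sub_split_le` with the walk-norm bound `m` DISCHARGED —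
`‖T_{V₀}(X)(q,κ) − (F̂X(q) − Ad_{V̄₀(c)}F̂X(q + Le_κ) + L·(Q₀X)(q,κ))‖ ≤ 210·α·((2d+2)L)·√(Σ_{s ∈ [0,L)ᵈ, ν}(‖X(q+s,ν)‖² + ‖X(q+Le_κ+s,ν)‖²))`
(every walk of (42) at `c` has length `≤ (2d+2)L` and is local in `B(c₋) ∪ B(c₊)`). The comb twin of ✓`Prop7TrueLinDefectBound.norm_defect_le_nbhd`. «(O2) groundwork.»
[cite: Balaban1985Averaging, (42) p.23, p.24, (124)-(126) p.36] -/
theorem norm_trueStep_defect_le_twoBlock (L : ℕ) (hL : 1 ≤ L) (V₀ : Site d → Fin d → 𝔸ˣ) (hV₀ : ∀ x μ, V₀ x μ ∈ unitaryUnits 𝔸)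
    (X : Site d → Fin d → 𝔸) (q : Site d) (κ : Fin d) {α : ℝ}
    (hα : ∀ r : Fin d → Fin L, ‖((Wcx L V₀ q κ (boxVec L r) : 𝔸ˣ) : 𝔸) - 1‖ ≤ α) (hα24 : α ≤ 1 / 24) :
    ‖fderiv ℂ (eml : ((Fin d → Fin L) → 𝔸) → 𝔸) (fun r => ((Wcx L V₀ q κ (boxVec L r) : 𝔸ˣ) : 𝔸))
          (fun r => tsum V₀ X q (gammaWord L κ (boxVec L r) ++ seg κ (-(L : ℤ))) * ((Wcx L V₀ q κ (boxVec L r) : 𝔸ˣ) : 𝔸))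
          * (((expUnit (Xavg L V₀ q κ))⁻¹ : 𝔸ˣ) : 𝔸)
        + ((expUnit (Xavg L V₀ q κ) : 𝔸ˣ) : 𝔸) * tsum V₀ X q (seg κ (L : ℤ)) * (((expUnit (Xavg L V₀ q κ))⁻¹ : 𝔸ˣ) : 𝔸)
        - (FhatCov L V₀ X q - conjR (bavg L V₀ q κ) (FhatCov L V₀ X (q + (L : ℤ) • e κ)) + (L : ℝ) • Q0cov L V₀ X q κ)‖
      ≤ 210 * α * ((2 * d + 2) * L * Real.sqrt (∑ s : Fin d → Fin L, ∑ ν : Fin d, (‖X (q + boxVec L s) ν‖ ^ 2 + ‖X (q + (L : ℤ) • e κ + boxVec L s) ν‖ ^ 2))) := by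
  set M : ℝ := Real.sqrt (∑ s : Fin d → Fin L, ∑ ν : Fin d, (‖X (q + boxVec L s) ν‖ ^ 2 + ‖X (q + (L : ℤ) • e κ + boxVec L s) ν‖ ^ 2)) with hM
  have hM0 : 0 ≤ M := Real.sqrt_nonneg _
  have hV₀' : ∀ x μ, V₀ x μ ∈ U1 𝔸 := fun x μ => unitaryUnits_le_U1 (hV₀ x μ)
  have hL0 : (0 : ℝ) ≤ L := Nat.cast_nonneg _
  -- the three families of walk norms, by locality + restriction
  have hΛ : ∀ r : Fin d → Fin L, ‖tsum V₀ X q (gammaWord L κ (boxVec L r) ++ seg κ (-(L : ℤ)))‖ ≤ (2 * d + 2) * L * M := by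
    intro r
    obtain ⟨hq, hqr, hqrL, hqL, hr0⟩ := inBox_loop_points L hL q κ r
    have h := norm_tsum_le_length_mul_sqrt_twoBlock L hL hV₀' X q κ q (gammaWord L κ (boxVec L r) ++ seg κ (-(L : ℤ)))
      (fun X' hX' => tsum_loop_congr V₀ L hX' q κ (boxVec L r) hr0 hq hqr hqrL hqL)
    refine h.trans (mul_le_mul_of_nonneg_right ?_ hM0)
    rw [List.length_append, B7Prop1Explicit.length_gammaWord, B7Prop1Explicit.length_seg]
    have hl1 := B7Prop1Explicit.l1_boxVec_le (L := L) r
    push_cast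
    have : ((B7Prop1Explicit.l1 (boxVec L r) : ℕ) : ℝ) ≤ d * L := by exact_mod_cast hl1
    simp only [Int.natAbs_neg, Int.natAbs_natCast]
    nlinarith
  have hS : ‖tsum V₀ X q (seg κ (L : ℤ))‖ ≤ (2 * d + 2) * L * M := by
    obtain ⟨hq, -, -, hqL, -⟩ := inBox_loop_points L hL q κ (fun _ => ⟨0, hL⟩)
    have h := norm_tsum_le_length_mul_sqrt_twoBlock L hL hV₀' X q κ q (seg κ (L : ℤ)) (fun X' hX' => tsum_seg_congr V₀ hX' κ L q hq hqL)
    refine h.trans (mul_le_mul_of_nonneg_right ?_ hM0)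
    rw [B7Prop1Explicit.length_seg]; simp only [Int.natAbs_natCast]; nlinarith
  have hT : ∀ r : Fin d → Fin L, ‖tsum V₀ X (q + (L : ℤ) • e κ) (treeWord (boxVec L r))‖ ≤ (2 * d + 2) * L * M := by
    intro r
    obtain ⟨-, -, hqrL, hqL, hr0⟩ := inBox_loop_points L hL q κ r
    have hqLr : InBox q (bondHi L q κ) (q + (L : ℤ) • e κ + boxVec L r) := by convert hqrL using 1; abel
    have h := norm_tsum_le_length_mul_sqrt_twoBlock L hL hV₀' X q κ (q + (L : ℤ) • e κ) (treeWord (boxVec L r))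
      (fun X' hX' => tsum_treeWord_congr V₀ hX' _ _ hr0 hqL hqLr)
    refine h.trans (mul_le_mul_of_nonneg_right ?_ hM0)
    rw [B7Prop1Explicit.length_treeWord]
    have hl1 := B7Prop1Explicit.l1_boxVec_le (L := L) r
    have : ((B7Prop1Explicit.l1 (boxVec L r) : ℕ) : ℝ) ≤ d * L := by exact_mod_cast hl1
    nlinarith
  have hm : 0 ≤ (2 * d + 2) * L * M := by positivity
  exact norm_trueStep_sub_split_le L hL V₀ hV₀ X q κ hm hΛ hS hT hα hα24

end Defect

end Summit.QuantumFields.YangMills.Theorems.Prop7CombTrueStepDefectTwoBlock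

end
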